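import Summits.Ventures.PercRepro.RankLevelSetRuleQSliceNegPolyTools

/-!
# PercRepro — THE NEGATIVE HALF OF THE SLICE MAP WITH A POLYNOMIAL THRESHOLD: `q ≥ 16(u+k)⁴` WHEN THE TRUNCATED TAIL IS SMALL
(night-1, gen 20; dossier §31.7)

RankLevelSetRuleQSliceNegAll proves `R̂(m+u, k, m) < Φ(m+u+k, m+u)` on every truncated slice `2 ≤ u ≤ k − 3` from
`m = 4^{k+3}` on, bounding every slice sum `S_j`, `j ≥ 3`, by `S₃ ≤ 1/Q`. With the decay of the diagonal slice sums
(`slice_diag_decay`) and their three-term recurrence (`slice_diag_rec`) the bound sharpens: writing `n = u + k`,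
* the untruncated terms `t_j = C(n, j)·D_j(q)`, `3 ≤ j ≤ u`, are GEOMETRICALLY DOMINATED — `t_{j+2} ≤ (t_j + t_{j+1})/8` as
  soon as `n² ≤ q` (`term_rec_le`, from the recurrence and `C(n, j+2)(j+2)(j+1) ≤ n²·C(n, j)`), so their sum is at most
  `2t₃ + 4t₄` (`slice_geom_dominated`), with `t₃ ≤ C(n,3)/q` and `t₄ ≤ C(n,4)·4(1+X)/q²`;
* the truncated terms `j > u` are at most `2^n·D_u(m)` (`m̂ ≥ C(q+a, a+u)`; `rhat_le_four_parts`);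
* **`rhat_lt_phiK_of_slice_poly`** — for `k ≥ 5`, `3 ≤ u ≤ k − 3`, `m ≥ (4n²)² = 16n⁴` and `2^n·D_u(m) ≤ 1/8`:
  `R̂(m+u, k, m) < Φ(m+u+k, m+u)`; the tail hypothesis is discharged by the decay — **`rhat_lt_phiK_of_slice_poly_odd`**
  (`u = 2i+1`: `24·2^n·(i+1)!·2^i ≤ m^i`) and **`rhat_lt_phiK_of_slice_poly_even`** (`u = 2i+2`:
  `96·2^n·(i+1)!·2^i ≤ 4n²·m^i`). Reading: on the wide truncated slices the first failure of Rule Q's equal split is at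
  most polynomial in `k` — e.g. on the last one, `u = k − 3`, from `q = 16(2k−3)⁴ + k − 3` on for every `k ≥ 6` (the tail
  hypotheses hold for every `k ≥ 6` by induction: `last_slice_tail_odd` / `_even`, **`rhat_lt_phiK_last_slice`**,
  `not_rhat_last_slice` in §5) — while for a fixed small `u` the tail `2^n·D_u(m) ≍ 2^{u+k}·m^{(1−u)/2}` is the true
  obstruction (dossier §31.5).
Twin: mining/night-1/g20/negall_twin.py §(6). Axioms: standard.
-/

namespace PercRepro

open Finset
/-! ### §4 The finish, and the theorems -/

/-- **The finish of the polynomial threshold, pure `ℚ`**: with `n = u + k ≤ 2k − 3`, `n ≥ 8`, `E = 4n²`, `E² ≤ q`,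
`X·E ≤ 2q + 1`, the two slice-sum bounds, `c₂ = n(n−1)/2`, `t₃·q ≤ n³/6`, `t₄·q² ≤ (n⁴/24)·4(1+X)` and `T ≤ 1/8`:
`n·S₁ + c₂·S₂ + (2t₃ + 4t₄) + T < k − 1` (the error terms are `≤ 1/64 + 1/16 + 1/4096 + 1/384 + 1/1536 + 1/8 < 1/2`). -/
lemma slice_neg_poly_finish (n k q E X S1 S2 t3 t4 T c2 : ℚ) (hn8 : 8 ≤ n) (hnk : n ≤ 2 * k - 3)
    (hE : E = 4 * n ^ 2) (hq : E ^ 2 ≤ q) (hXE : X * E ≤ 2 * q + 1)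
    (hS1 : S1 ≤ 1 / 2 + X / (2 * (2 * q + 1))) (hS2 : S2 ≤ 1 / (2 * (q + 1)) + X / (2 * (2 * q + 1)))
    (hc2 : c2 = n * (n - 1) / 2) (ht3 : 0 ≤ t3) (ht3' : t3 * q ≤ n ^ 3 / 6) (ht4 : 0 ≤ t4)
    (ht4' : t4 * q ^ 2 ≤ n ^ 4 / 24 * (4 * (1 + X))) (hT : T ≤ 1 / 8) :
    n * S1 + c2 * S2 + (2 * t3 + 4 * t4) + T < k - 1 := by
  have hn0 : 0 < n := by linarith
  have hn64 : (64 : ℚ) ≤ n ^ 2 := by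
    calc (64 : ℚ) = 8 * 8 := by norm_num
      _ ≤ n * n := mul_le_mul hn8 hn8 (by norm_num) hn0.le
      _ = n ^ 2 := by ring
  have hE256 : 256 ≤ E := by rw [hE]; linarith
  have hEpos : 0 < E := by linarith
  have hqE : E ≤ q := by
    calc E = E * 1 := by ring
      _ ≤ E * E := mul_le_mul_of_nonneg_left (by linarith) hEpos.le
      _ = E ^ 2 := by ring
      _ ≤ q := hq
  have hqpos : 0 < q := by linarith
  have hq16 : 16 * n ^ 4 ≤ q := by
    have : E ^ 2 = 16 * n ^ 4 := by rw [hE]; ring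
    linarith
  have hc2nn : 0 ≤ c2 := by rw [hc2]; exact div_nonneg (mul_nonneg hn0.le (by linarith)) (by norm_num)
  have hc2n : c2 ≤ n ^ 2 / 2 := by
    rw [hc2]
    have : n * (n - 1) = n ^ 2 - n := by ring
    rw [this]; linarith
  -- the S₁ part: n·S1 ≤ n/2 + 1/64
  have hXq : X / (2 * (2 * q + 1)) ≤ 1 / (2 * E) := by
    rw [div_le_div_iff₀ (by positivity) (by positivity)]; linarith [hXE]
  have hA : n * S1 ≤ n / 2 + n * (1 / (2 * E)) := by
    have h := mul_le_mul_of_nonneg_left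
      (hS1.trans (by linarith [hXq] : 1 / 2 + X / (2 * (2 * q + 1)) ≤ 1 / 2 + 1 / (2 * E))) hn0.le
    linarith
  have hA' : n * (1 / (2 * E)) ≤ 1 / 64 := by
    rw [mul_one_div, div_le_div_iff₀ (by positivity) (by norm_num), hE]
    have : n * 64 ≤ n * (8 * n) := mul_le_mul_of_nonneg_left (by linarith) hn0.le
    linarith
  -- the S₂ part: c2·S2 ≤ 1/4096 + 1/16
  have hB : c2 * S2 ≤ c2 * (1 / (2 * (q + 1))) + c2 * (1 / (2 * E)) := by
    have h := mul_le_mul_of_nonneg_left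
      (hS2.trans (by linarith [hXq] : 1 / (2 * (q + 1)) + X / (2 * (2 * q + 1)) ≤ 1 / (2 * (q + 1)) + 1 / (2 * E))) hc2nn
    linarith
  have hB1 : c2 * (1 / (2 * E)) ≤ 1 / 16 := by
    rw [mul_one_div, div_le_div_iff₀ (by positivity) (by norm_num), hE]
    linarith [hc2n]
  have hB2 : c2 * (1 / (2 * (q + 1))) ≤ 1 / 4096 := by
    rw [mul_one_div, div_le_div_iff₀ (by positivity) (by norm_num)]
    have e : 16 * n ^ 4 - 1024 * n ^ 2 = 16 * n ^ 2 * (n ^ 2 - 64) := by ring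
    have hm : 0 ≤ 16 * n ^ 2 * (n ^ 2 - 64) := mul_nonneg (by positivity) (by linarith)
    linarith [hc2n, hq16]
  -- the untruncated tail: 2t₃ ≤ 1/384, 4t₄ ≤ 1/1536
  have hC : 2 * t3 ≤ 1 / 384 := by
    have h2 : t3 * (16 * n ^ 4) ≤ t3 * q := mul_le_mul_of_nonneg_left hq16 ht3
    have h3 : t3 * (16 * n ^ 4) ≤ n ^ 3 / 6 := h2.trans ht3'
    have h4' : (t3 * 96 * n) * n ^ 3 ≤ 1 * n ^ 3 := by linarith [h3]
    have h4 : t3 * 96 * n ≤ 1 := le_of_mul_le_mul_right h4' (pow_pos hn0 3)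
    have h5 : t3 * 96 * 8 ≤ t3 * 96 * n := mul_le_mul_of_nonneg_left hn8 (by positivity)
    linarith
  have hD : 4 * t4 ≤ 1 / 1536 := by
    have h1X : (1 + X) * E ≤ 4 * q := by
      have : (1 + X) * E = E + X * E := by ring
      linarith [hXE, hqE]
    have h2 : t4 * q ^ 2 * E ≤ n ^ 4 / 24 * 4 * (4 * q) := by
      calc t4 * q ^ 2 * E ≤ n ^ 4 / 24 * (4 * (1 + X)) * E := mul_le_mul_of_nonneg_right ht4' hEpos.le
        _ = n ^ 4 / 24 * 4 * ((1 + X) * E) := by ring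
        _ ≤ n ^ 4 / 24 * 4 * (4 * q) := mul_le_mul_of_nonneg_left h1X (by positivity)
    have h3 : t4 * q * E ≤ n ^ 4 / 24 * 16 := by
      have h2' : (t4 * q * E) * q ≤ (n ^ 4 / 24 * 16) * q := by linarith [h2]
      exact le_of_mul_le_mul_right h2' hqpos
    have h4 : t4 * (16 * n ^ 4) * (4 * n ^ 2) ≤ n ^ 4 / 24 * 16 := by
      have h5 : t4 * (16 * n ^ 4) ≤ t4 * q := mul_le_mul_of_nonneg_left hq16 ht4
      have h6 : t4 * (16 * n ^ 4) * (4 * n ^ 2) ≤ t4 * q * E := by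
        rw [hE]; exact mul_le_mul_of_nonneg_right h5 (by positivity)
      exact h6.trans h3
    have h6' : (t4 * 96 * n ^ 2) * n ^ 4 ≤ 1 * n ^ 4 := by linarith [h4]
    have h6 : t4 * 96 * n ^ 2 ≤ 1 := le_of_mul_le_mul_right h6' (pow_pos hn0 4)
    have h7 : t4 * 96 * 64 ≤ t4 * 96 * n ^ 2 := mul_le_mul_of_nonneg_left hn64 (by positivity)
    linarith
  have hnk' : n / 2 ≤ (2 * k - 3) / 2 := by linarith
  linarith [hA, hA', hB, hB1, hB2, hC, hD, hT, hnk']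


/-- **The negative half with a polynomial threshold**: for `k ≥ 5`, `3 ≤ u ≤ k − 3`, `m ≥ (4(u+k)²)² = 16(u+k)⁴` and a small
truncated tail `2^{u+k}·D_u(m) ≤ 1/8` (`D_u(m) = Σ_{a ≤ m} C(m, a)/C(m+u+a, a+u)`, the diagonal slice sum):
`R̂(m+u, k, m) < Φ(m+u+k, m+u)`. -/
theorem rhat_lt_phiK_of_slice_poly (k u m : ℕ) (hk : 5 ≤ k) (hu : 3 ≤ u) (huk : u + 3 ≤ k)
    (hm : (4 * (u + k) ^ 2) ^ 2 ≤ m)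
    (hT : (2 : ℚ) ^ (u + k) * ∑ a ∈ range (m + 1), (m.choose a : ℚ) / ((m + u + a).choose (a + u) : ℚ) ≤ 1 / 8) :
    rhat (m + u) k m < phiK (m + u + k) (m + u) := by
  have hphi := phiK_ge_sub_one (m + u) k (by omega)
  have hR := rhat_le_four_parts k m u hu (by omega)
  have hE2 : (4 * (u + k) ^ 2) ^ 2 ≤ m + u := by omega
  have hq1 : 1 ≤ m + u := by omega
  have hn2 : (u + k) ^ 2 ≤ m + u := by nlinarith [hm]
  -- the two leading slice sums against the diagonal
  have hS1 := (slice_mono_m (m + u) 1 (by omega : m ≤ m + u)).trans (slice_one_diag (m + u)).le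
  have hS2 := (slice_mono_m (m + u) 2 (by omega : m ≤ m + u)).trans (slice_two_diag (m + u)).le
  -- the untruncated tail: geometric domination of t_j = C(u+k, j)·D_j(m+u)
  set t : ℕ → ℚ := fun j => ((u + k).choose j : ℚ)
    * ∑ a ∈ range (m + u + 1), ((m + u).choose a : ℚ) / ((m + u + j + a).choose (a + j) : ℚ) with ht
  have ht0 : ∀ j, 0 ≤ t j := fun j => by rw [ht]; exact mul_nonneg (by positivity) (Finset.sum_nonneg (fun a _ => by positivity))
  have hrec : ∀ j, 3 ≤ j → t (j + 2) ≤ (t j + t (j + 1)) / 8 := fun j hj => by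
    rw [ht]; exact term_rec_le (u + k) (m + u) j hn2 hj
  have hU : ∑ i ∈ range (u - 2), ((u + k).choose (i + 3) : ℚ)
        * ∑ a ∈ range (m + 1), (m.choose a : ℚ) / ((m + u + (i + 3) + a).choose (a + (i + 3)) : ℚ)
      ≤ 2 * t 3 + 4 * t 4 := by
    refine le_trans (Finset.sum_le_sum (fun i _ => ?_)) (slice_geom_dominated t ht0 hrec (u - 2))
    rw [ht]
    exact mul_le_mul_of_nonneg_left (slice_mono_m (m + u) (i + 3) (by omega : m ≤ m + u)) (by positivity)
  -- t₃·q ≤ C(n,3) ≤ n³/6 and t₄·q² ≤ C(n,4)·4(1+X) ≤ (n⁴/24)·4(1+X)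
  have ht3 : t 3 * ((m + u : ℕ) : ℚ) ≤ ((u : ℚ) + k) ^ 3 / 6 := by
    rw [ht]
    have h1 := slice_three_diag_le (m + u) hq1
    have h2 : (((u + k).choose 3 : ℕ) : ℚ) ≤ ((u + k : ℕ) : ℚ) ^ 3 / (Nat.factorial 3 : ℚ) := Nat.choose_le_pow_div 3 (u + k)
    have hqpos : (0 : ℚ) < ((m + u : ℕ) : ℚ) := by exact_mod_cast hq1
    have h3 : ((u + k).choose 3 : ℚ) * ∑ a ∈ range (m + u + 1), ((m + u).choose a : ℚ) / ((m + u + 3 + a).choose (a + 3) : ℚ)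
        ≤ ((u + k).choose 3 : ℚ) * (1 / ((m + u : ℕ) : ℚ)) := mul_le_mul_of_nonneg_left h1 (by positivity)
    calc ((u + k).choose 3 : ℚ) * (∑ a ∈ range (m + u + 1), ((m + u).choose a : ℚ) / ((m + u + 3 + a).choose (a + 3) : ℚ))
          * ((m + u : ℕ) : ℚ)
        ≤ ((u + k).choose 3 : ℚ) * (1 / ((m + u : ℕ) : ℚ)) * ((m + u : ℕ) : ℚ) := mul_le_mul_of_nonneg_right h3 hqpos.le
      _ = ((u + k).choose 3 : ℚ) := by field_simp
      _ ≤ ((u : ℚ) + k) ^ 3 / 6 := by push_cast at h2 ⊢; norm_num [Nat.factorial] at h2 ⊢; linarith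
  have ht4 : t 4 * ((m + u : ℕ) : ℚ) ^ 2
      ≤ ((u : ℚ) + k) ^ 4 / 24 * (4 * (1 + (4 : ℚ) ^ (m + u) / ((2 * (m + u)).choose (m + u) : ℚ))) := by
    rw [ht]
    have h1 := (slice_diag_decay (m + u) hq1 1).2
    simp only [show 2 * 1 + 2 = 4 from rfl, show (1 + 1 : ℕ) = 2 from rfl, Nat.factorial_two, Nat.cast_ofNat, pow_one] at h1
    have h2 : (((u + k).choose 4 : ℕ) : ℚ) ≤ ((u + k : ℕ) : ℚ) ^ 4 / (Nat.factorial 4 : ℚ) := Nat.choose_le_pow_div 4 (u + k)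
    have hX0 : (0 : ℚ) ≤ (4 : ℚ) ^ (m + u) / ((2 * (m + u)).choose (m + u) : ℚ) := by positivity
    calc ((u + k).choose 4 : ℚ) * (∑ a ∈ range (m + u + 1), ((m + u).choose a : ℚ) / ((m + u + 4 + a).choose (a + 4) : ℚ))
          * ((m + u : ℕ) : ℚ) ^ 2
        = ((u + k).choose 4 : ℚ) * ((∑ a ∈ range (m + u + 1), ((m + u).choose a : ℚ) / ((m + u + 4 + a).choose (a + 4) : ℚ))
          * ((m + u : ℕ) : ℚ) ^ (1 + 1)) := by ring
      _ ≤ ((u + k).choose 4 : ℚ) * (2 * 2 * (1 + (4 : ℚ) ^ (m + u) / ((2 * (m + u)).choose (m + u) : ℚ))) :=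
          mul_le_mul_of_nonneg_left h1 (by positivity)
      _ ≤ ((u : ℚ) + k) ^ 4 / 24 * (4 * (1 + (4 : ℚ) ^ (m + u) / ((2 * (m + u)).choose (m + u) : ℚ))) := by
          push_cast at h2
          norm_num [Nat.factorial] at h2
          have : ((u + k).choose 4 : ℚ) * (2 * 2 * (1 + (4 : ℚ) ^ (m + u) / ((2 * (m + u)).choose (m + u) : ℚ)))
              ≤ ((u : ℚ) + k) ^ 4 / 24 * (2 * 2 * (1 + (4 : ℚ) ^ (m + u) / ((2 * (m + u)).choose (m + u) : ℚ))) :=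
            mul_le_mul_of_nonneg_right h2 (by positivity)
          linarith
  -- the truncated tail
  have hTr : (∑ i ∈ range (k - 1 - u), ((u + k).choose (u + 1 + i) : ℚ))
        * ∑ a ∈ range (m + 1), (m.choose a : ℚ) / ((m + u + a).choose (a + u) : ℚ) ≤ 1 / 8 := by
    refine le_trans (mul_le_mul_of_nonneg_right (sum_choose_shift_le_two_pow (u + k) (u + 1) (k - 1 - u) (by omega))
      (Finset.sum_nonneg (fun a _ => by positivity))) hT
  -- Wallis with E = 4(u+k)²
  have hXE := xq_mul_le (m + u) (4 * (u + k) ^ 2) hq1 hE2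
  have hc2 : (((u + k).choose 2 : ℕ) : ℚ) = ((u : ℚ) + k) * (((u : ℚ) + k) - 1) / 2 := by
    rw [Nat.cast_choose_two]; push_cast; ring
  have hfin := slice_neg_poly_finish ((u : ℚ) + k) k ((m + u : ℕ) : ℚ) (4 * ((u : ℚ) + k) ^ 2)
    ((4 : ℚ) ^ (m + u) / ((2 * (m + u)).choose (m + u) : ℚ))
    (∑ a ∈ range (m + 1), (m.choose a : ℚ) / ((m + u + 1 + a).choose (a + 1) : ℚ))
    (∑ a ∈ range (m + 1), (m.choose a : ℚ) / ((m + u + 2 + a).choose (a + 2) : ℚ))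
    (t 3) (t 4)
    ((∑ i ∈ range (k - 1 - u), ((u + k).choose (u + 1 + i) : ℚ))
        * ∑ a ∈ range (m + 1), (m.choose a : ℚ) / ((m + u + a).choose (a + u) : ℚ))
    (((u + k).choose 2 : ℕ) : ℚ)
    (by exact_mod_cast (by omega : 8 ≤ u + k))
    (by have : (u : ℚ) + 3 ≤ k := by exact_mod_cast huk
        linarith) rfl
    (by exact_mod_cast hE2) (by push_cast at hXE ⊢; linarith [hXE])
    (by push_cast at hS1 ⊢; exact hS1) (by push_cast at hS2 ⊢; exact hS2) hc2 (ht0 3) ht3 (ht0 4) ht4 hTr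
  push_cast at hR hphi hfin ⊢
  linarith [hR, hphi, hfin, hU]

/-- **The odd slices `u = 2i + 1`, tail discharged by the decay**: for `k ≥ 5`, `i ≥ 1`, `2i + 4 ≤ k`,
`m ≥ 16(2i+1+k)⁴` and `24·2^{2i+1+k}·(i+1)!·2^i ≤ m^i`: `R̂(m + (2i+1), k, m) < Φ`. -/
theorem rhat_lt_phiK_of_slice_poly_odd (k i m : ℕ) (hk : 5 ≤ k) (hi : 1 ≤ i) (huk : 2 * i + 1 + 3 ≤ k)
    (hm : (4 * (2 * i + 1 + k) ^ 2) ^ 2 ≤ m) (hT : 24 * 2 ^ (2 * i + 1 + k) * (i + 1).factorial * 2 ^ i ≤ m ^ i) :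
    rhat (m + (2 * i + 1)) k m < phiK (m + (2 * i + 1) + k) (m + (2 * i + 1)) := by
  refine rhat_lt_phiK_of_slice_poly k (2 * i + 1) m hk (by omega) huk hm ?_
  have hm1 : 1 ≤ m := by
    have : 1 ≤ (4 * (2 * i + 1 + k) ^ 2) ^ 2 := Nat.one_le_pow _ _ (by positivity)
    omega
  have hd := (slice_diag_decay m hm1 i).1
  have hmpos : (0 : ℚ) < (m : ℚ) ^ i := by positivity
  have hT' : (24 : ℚ) * 2 ^ (2 * i + 1 + k) * ((i + 1).factorial : ℚ) * 2 ^ i ≤ (m : ℚ) ^ i := by exact_mod_cast hT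
  set D := ∑ a ∈ range (m + 1), (m.choose a : ℚ) / ((m + (2 * i + 1) + a).choose (a + (2 * i + 1)) : ℚ) with hD
  have hD0 : 0 ≤ D := Finset.sum_nonneg (fun a _ => by positivity)
  have h1 : (2 : ℚ) ^ (2 * i + 1 + k) * D * (m : ℚ) ^ i ≤ (m : ℚ) ^ i / 24 := by
    calc (2 : ℚ) ^ (2 * i + 1 + k) * D * (m : ℚ) ^ i = (2 : ℚ) ^ (2 * i + 1 + k) * (D * (m : ℚ) ^ i) := by ring
      _ ≤ (2 : ℚ) ^ (2 * i + 1 + k) * (((i + 1).factorial : ℚ) * 2 ^ i) := mul_le_mul_of_nonneg_left hd (by positivity)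
      _ ≤ (m : ℚ) ^ i / 24 := by rw [le_div_iff₀ (by norm_num)]; linarith [hT']
  have h2 : (2 : ℚ) ^ (2 * i + 1 + k) * D ≤ 1 / 24 := by
    have := le_of_mul_le_mul_right (by rw [div_eq_mul_one_div] at h1; linarith [h1] :
      (2 : ℚ) ^ (2 * i + 1 + k) * D * (m : ℚ) ^ i ≤ 1 / 24 * (m : ℚ) ^ i) hmpos
    exact this
  linarith

/-- **The even slices `u = 2i + 2`, tail discharged by the decay**: for `k ≥ 5`, `i ≥ 1`, `2i + 5 ≤ k`,
`m ≥ 16(2i+2+k)⁴` and `96·2^{2i+2+k}·(i+1)!·2^i ≤ 4(2i+2+k)²·m^i`: `R̂(m + (2i+2), k, m) < Φ`. -/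
theorem rhat_lt_phiK_of_slice_poly_even (k i m : ℕ) (hk : 5 ≤ k) (hi : 1 ≤ i) (huk : 2 * i + 2 + 3 ≤ k)
    (hm : (4 * (2 * i + 2 + k) ^ 2) ^ 2 ≤ m)
    (hT : 96 * 2 ^ (2 * i + 2 + k) * (i + 1).factorial * 2 ^ i ≤ 4 * (2 * i + 2 + k) ^ 2 * m ^ i) :
    rhat (m + (2 * i + 2)) k m < phiK (m + (2 * i + 2) + k) (m + (2 * i + 2)) := by
  refine rhat_lt_phiK_of_slice_poly k (2 * i + 2) m hk (by omega) huk hm ?_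
  have hm1 : 1 ≤ m := by
    have : 1 ≤ (4 * (2 * i + 2 + k) ^ 2) ^ 2 := Nat.one_le_pow _ _ (by positivity)
    omega
  have hd := (slice_diag_decay m hm1 i).2
  set E : ℕ := 4 * (2 * i + 2 + k) ^ 2 with hE
  have hE1 : 1 ≤ E := by rw [hE]; exact Nat.one_le_iff_ne_zero.2 (by positivity)
  have hEm : E ≤ m := by
    have : E ≤ E ^ 2 := by nlinarith
    omega
  have hXE := xq_mul_le m E hm1 hm
  set X := (4 : ℚ) ^ m / ((2 * m).choose m : ℚ) with hX
  have hX0 : 0 ≤ X := by positivity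
  have hmpos : (0 : ℚ) < (m : ℚ) ^ i := by positivity
  have hEpos : (0 : ℚ) < (E : ℚ) := by exact_mod_cast hE1
  have hmq : (0 : ℚ) < (m : ℚ) := by exact_mod_cast hm1
  have hEm' : (E : ℚ) ≤ m := by exact_mod_cast hEm
  have hT' : (96 : ℚ) * 2 ^ (2 * i + 2 + k) * ((i + 1).factorial : ℚ) * 2 ^ i ≤ (E : ℚ) * (m : ℚ) ^ i := by
    rw [hE]; exact_mod_cast hT
  set D := ∑ a ∈ range (m + 1), (m.choose a : ℚ) / ((m + (2 * i + 2) + a).choose (a + (2 * i + 2)) : ℚ) with hD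
  have hD0 : 0 ≤ D := Finset.sum_nonneg (fun a _ => by positivity)
  set F := ((i + 1).factorial : ℚ) * 2 ^ i with hF
  have hF0 : 0 ≤ F := by positivity
  -- (1 + X)·E ≤ 4m
  have hm1' : (1 : ℚ) ≤ m := by exact_mod_cast hm1
  have h1X : (1 + X) * E ≤ 4 * (m : ℚ) := by
    have : (1 + X) * E = E + X * E := by ring
    linarith [hXE, hEm', hm1']
  -- D·m^{i+1}·E ≤ F·(1+X)·E ≤ 4 F m  ⇒  D·m^i·E ≤ 4F
  have h2 : D * (m : ℚ) ^ (i + 1) * E ≤ 4 * F * m := by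
    calc D * (m : ℚ) ^ (i + 1) * E ≤ F * (1 + X) * E := mul_le_mul_of_nonneg_right hd hEpos.le
      _ = F * ((1 + X) * E) := by ring
      _ ≤ F * (4 * m) := mul_le_mul_of_nonneg_left h1X hF0
      _ = 4 * F * m := by ring
  have h3 : D * (m : ℚ) ^ i * E ≤ 4 * F := by
    have h2' : (D * (m : ℚ) ^ i * E) * (m : ℚ) ≤ (4 * F) * (m : ℚ) := by
      have : D * (m : ℚ) ^ (i + 1) * E = (D * (m : ℚ) ^ i * E) * (m : ℚ) := by ring
      linarith [h2]
    exact le_of_mul_le_mul_right h2' hmq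
  -- 2^n D · (E m^i) ≤ 4·2^n F ≤ E m^i / 24
  have h4 : (2 : ℚ) ^ (2 * i + 2 + k) * D * ((E : ℚ) * (m : ℚ) ^ i) ≤ (E : ℚ) * (m : ℚ) ^ i / 24 := by
    calc (2 : ℚ) ^ (2 * i + 2 + k) * D * ((E : ℚ) * (m : ℚ) ^ i)
        = (2 : ℚ) ^ (2 * i + 2 + k) * (D * (m : ℚ) ^ i * E) := by ring
      _ ≤ (2 : ℚ) ^ (2 * i + 2 + k) * (4 * F) := mul_le_mul_of_nonneg_left h3 (by positivity)
      _ ≤ (E : ℚ) * (m : ℚ) ^ i / 24 := by rw [le_div_iff₀ (by norm_num), hF]; linarith [hT']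
  have hEmpos : (0 : ℚ) < (E : ℚ) * (m : ℚ) ^ i := by positivity
  have h5 : (2 : ℚ) ^ (2 * i + 2 + k) * D ≤ 1 / 24 := by
    have := le_of_mul_le_mul_right (by rw [div_eq_mul_one_div] at h4; linarith [h4] :
      (2 : ℚ) ^ (2 * i + 2 + k) * D * ((E : ℚ) * (m : ℚ) ^ i) ≤ 1 / 24 * ((E : ℚ) * (m : ℚ) ^ i)) hEmpos
    exact this
  linarith


/-! ### §5 The last truncated slice `u = k − 3`, every `k ≥ 6` -/

/-- The tail hypothesis on the last truncated slice, even `k = 2i + 4` (`u = 2i + 1`, `n = 4i + 5`):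
`24·2^{4i+5}·(i+1)!·2^i ≤ (16(4i+5)⁴)^i` for `i ≥ 1` (induction from `49152 ≤ 104976`). -/
lemma last_slice_tail_odd : ∀ i : ℕ, 1 ≤ i → 24 * 2 ^ (2 * i + 1 + (2 * i + 4)) * (i + 1).factorial * 2 ^ i ≤ (16 * (4 * i + 5) ^ 4) ^ i := by
  intro i hi
  induction i, hi using Nat.le_induction with
  | base => decide
  | succ i hi ih =>
    have hstep : 24 * 2 ^ (2 * (i + 1) + 1 + (2 * (i + 1) + 4)) * (i + 1 + 1).factorial * 2 ^ (i + 1)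
        = (24 * 2 ^ (2 * i + 1 + (2 * i + 4)) * (i + 1).factorial * 2 ^ i) * (32 * (i + 2)) := by
      rw [Nat.factorial_succ]
      rw [show 2 * (i + 1) + 1 + (2 * (i + 1) + 4) = (2 * i + 1 + (2 * i + 4)) + 4 by ring, pow_add, pow_succ]
      ring
    have hmono : (16 * (4 * i + 5) ^ 4) ^ i ≤ (16 * (4 * (i + 1) + 5) ^ 4) ^ i :=
      Nat.pow_le_pow_left (Nat.mul_le_mul_left _ (Nat.pow_le_pow_left (by omega) 4)) i
    have hfac : 32 * (i + 2) ≤ 16 * (4 * (i + 1) + 5) ^ 4 := by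
      have h1 : 2 * (i + 2) ≤ (4 * (i + 1) + 5) ^ 4 :=
        le_trans (by omega : 2 * (i + 2) ≤ 4 * (i + 1) + 5) (Nat.le_self_pow (by norm_num) _)
      calc 32 * (i + 2) = 16 * (2 * (i + 2)) := by ring
        _ ≤ 16 * (4 * (i + 1) + 5) ^ 4 := Nat.mul_le_mul_left _ h1
    calc 24 * 2 ^ (2 * (i + 1) + 1 + (2 * (i + 1) + 4)) * (i + 1 + 1).factorial * 2 ^ (i + 1)
        = (24 * 2 ^ (2 * i + 1 + (2 * i + 4)) * (i + 1).factorial * 2 ^ i) * (32 * (i + 2)) := hstep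
      _ ≤ (16 * (4 * i + 5) ^ 4) ^ i * (32 * (i + 2)) := Nat.mul_le_mul_right _ ih
      _ ≤ (16 * (4 * (i + 1) + 5) ^ 4) ^ i * (16 * (4 * (i + 1) + 5) ^ 4) := Nat.mul_le_mul hmono hfac
      _ = (16 * (4 * (i + 1) + 5) ^ 4) ^ (i + 1) := by ring

/-- The tail hypothesis on the last truncated slice, odd `k = 2i + 5` (`u = 2i + 2`, `n = 4i + 7`):
`96·2^{4i+7}·(i+1)!·2^i ≤ 4(4i+7)²·(16(4i+7)⁴)^i` for `i ≥ 1`. -/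
lemma last_slice_tail_even : ∀ i : ℕ, 1 ≤ i →
    96 * 2 ^ (2 * i + 2 + (2 * i + 5)) * (i + 1).factorial * 2 ^ i ≤ 4 * (4 * i + 7) ^ 2 * (16 * (4 * i + 7) ^ 4) ^ i := by
  intro i hi
  induction i, hi using Nat.le_induction with
  | base => decide
  | succ i hi ih =>
    have hstep : 96 * 2 ^ (2 * (i + 1) + 2 + (2 * (i + 1) + 5)) * (i + 1 + 1).factorial * 2 ^ (i + 1)
        = (96 * 2 ^ (2 * i + 2 + (2 * i + 5)) * (i + 1).factorial * 2 ^ i) * (32 * (i + 2)) := by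
      rw [Nat.factorial_succ]
      rw [show 2 * (i + 1) + 2 + (2 * (i + 1) + 5) = (2 * i + 2 + (2 * i + 5)) + 4 by ring, pow_add, pow_succ]
      ring
    have hmono1 : (16 * (4 * i + 7) ^ 4) ^ i ≤ (16 * (4 * (i + 1) + 7) ^ 4) ^ i :=
      Nat.pow_le_pow_left (Nat.mul_le_mul_left _ (Nat.pow_le_pow_left (by omega) 4)) i
    have hmono2 : 4 * (4 * i + 7) ^ 2 ≤ 4 * (4 * (i + 1) + 7) ^ 2 :=
      Nat.mul_le_mul_left _ (Nat.pow_le_pow_left (by omega) 2)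
    have hfac : 32 * (i + 2) ≤ 16 * (4 * (i + 1) + 7) ^ 4 := by
      have h1 : 2 * (i + 2) ≤ (4 * (i + 1) + 7) ^ 4 :=
        le_trans (by omega : 2 * (i + 2) ≤ 4 * (i + 1) + 7) (Nat.le_self_pow (by norm_num) _)
      calc 32 * (i + 2) = 16 * (2 * (i + 2)) := by ring
        _ ≤ 16 * (4 * (i + 1) + 7) ^ 4 := Nat.mul_le_mul_left _ h1
    calc 96 * 2 ^ (2 * (i + 1) + 2 + (2 * (i + 1) + 5)) * (i + 1 + 1).factorial * 2 ^ (i + 1)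
        = (96 * 2 ^ (2 * i + 2 + (2 * i + 5)) * (i + 1).factorial * 2 ^ i) * (32 * (i + 2)) := hstep
      _ ≤ (4 * (4 * i + 7) ^ 2 * (16 * (4 * i + 7) ^ 4) ^ i) * (32 * (i + 2)) := Nat.mul_le_mul_right _ ih
      _ ≤ (4 * (4 * (i + 1) + 7) ^ 2 * (16 * (4 * (i + 1) + 7) ^ 4) ^ i) * (16 * (4 * (i + 1) + 7) ^ 4) :=
          Nat.mul_le_mul (Nat.mul_le_mul hmono2 hmono1) hfac
      _ = 4 * (4 * (i + 1) + 7) ^ 2 * (16 * (4 * (i + 1) + 7) ^ 4) ^ (i + 1) := by ring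


/-- **The last truncated slice fails from a polynomial `q` on, even `k`**: `k = 2i + 4`, `u = 2i + 1`, `m ≥ 16(4i+5)⁴`. -/
theorem rhat_lt_phiK_last_slice_even_k (i m : ℕ) (hi : 1 ≤ i) (hm : 16 * (4 * i + 5) ^ 4 ≤ m) :
    rhat (m + (2 * i + 1)) (2 * i + 4) m < phiK (m + (2 * i + 1) + (2 * i + 4)) (m + (2 * i + 1)) := by
  have hE : (4 * (2 * i + 1 + (2 * i + 4)) ^ 2) ^ 2 = 16 * (4 * i + 5) ^ 4 := by ring
  refine rhat_lt_phiK_of_slice_poly_odd (2 * i + 4) i m (by omega) hi (by omega) (by rw [hE]; exact hm) ?_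
  calc 24 * 2 ^ (2 * i + 1 + (2 * i + 4)) * (i + 1).factorial * 2 ^ i ≤ (16 * (4 * i + 5) ^ 4) ^ i :=
        last_slice_tail_odd i hi
    _ ≤ m ^ i := Nat.pow_le_pow_left hm i

/-- **The last truncated slice fails from a polynomial `q` on, odd `k`**: `k = 2i + 5`, `u = 2i + 2`, `m ≥ 16(4i+7)⁴`. -/
theorem rhat_lt_phiK_last_slice_odd_k (i m : ℕ) (hi : 1 ≤ i) (hm : 16 * (4 * i + 7) ^ 4 ≤ m) :
    rhat (m + (2 * i + 2)) (2 * i + 5) m < phiK (m + (2 * i + 2) + (2 * i + 5)) (m + (2 * i + 2)) := by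
  have hE : (4 * (2 * i + 2 + (2 * i + 5)) ^ 2) ^ 2 = 16 * (4 * i + 7) ^ 4 := by ring
  refine rhat_lt_phiK_of_slice_poly_even (2 * i + 5) i m (by omega) hi (by omega) (by rw [hE]; exact hm) ?_
  calc 96 * 2 ^ (2 * i + 2 + (2 * i + 5)) * (i + 1).factorial * 2 ^ i
      ≤ 4 * (4 * i + 7) ^ 2 * (16 * (4 * i + 7) ^ 4) ^ i := last_slice_tail_even i hi
    _ ≤ 4 * (2 * i + 2 + (2 * i + 5)) ^ 2 * m ^ i := by
        rw [show 2 * i + 2 + (2 * i + 5) = 4 * i + 7 by ring]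
        exact Nat.mul_le_mul_left _ (Nat.pow_le_pow_left hm i)

/-- **THE LAST TRUNCATED SLICE, EVERY `k ≥ 6`**: `R̂(m + (k−3), k, m) < Φ(m + (k−3) + k, m + (k−3))` for every
`m ≥ 16(2k−3)⁴` — Rule Q's equal split fails on the slice `u = k − 3` of the family `k` from `q = 16(2k−3)⁴ + k − 3` on. -/
theorem rhat_lt_phiK_last_slice (k m : ℕ) (hk : 6 ≤ k) (hm : 16 * (2 * k - 3) ^ 4 ≤ m) :
    rhat (m + (k - 3)) k m < phiK (m + (k - 3) + k) (m + (k - 3)) := by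
  rcases Nat.even_or_odd k with ⟨j, hj⟩ | ⟨j, hj⟩
  · obtain ⟨i, rfl⟩ : ∃ i, j = i + 2 := ⟨j - 2, by omega⟩
    have hk' : k = 2 * i + 4 := by omega
    subst hk'
    rw [show 2 * i + 4 - 3 = 2 * i + 1 by omega]
    rw [show 2 * (2 * i + 4) - 3 = 4 * i + 5 by omega] at hm
    exact rhat_lt_phiK_last_slice_even_k i m (by omega) hm
  · obtain ⟨i, rfl⟩ : ∃ i, j = i + 2 := ⟨j - 2, by omega⟩
    have hk' : k = 2 * i + 5 := by omega
    subst hk'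
    rw [show 2 * i + 5 - 3 = 2 * i + 2 by omega]
    rw [show 2 * (2 * i + 5) - 3 = 4 * i + 7 by omega] at hm
    exact rhat_lt_phiK_last_slice_odd_k i m (by omega) hm

/-- The slice `u = k − 3` is not paid by Rule Q's equal split on every cell, for every `k ≥ 6`, with the explicit witness
`q = 16(2k−3)⁴ + k − 3`. -/
theorem not_rhat_last_slice (k : ℕ) (hk : 6 ≤ k) :
    ¬ ∀ q, k - 3 ≤ q → phiK (q + k) q ≤ rhat q k (q - (k - 3)) := by
  intro h
  have h' := h (16 * (2 * k - 3) ^ 4 + (k - 3)) (Nat.le_add_left _ _)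
  rw [Nat.add_sub_cancel] at h'
  exact absurd h' (not_le.2 (rhat_lt_phiK_last_slice k (16 * (2 * k - 3) ^ 4) hk le_rfl))

end PercRepro
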